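import Literature.NumberTheory.EllipticCurves.NewformAbelianVariety
import Literature.NumberTheory.EllipticCurves.CuspFormLFunctionProofs
import HarnessLib

/-!
# BirchSwinnertonDyer / ShadowIsolation — crux `PhantomShadow` (stmt-BirchSwinnertonDyer-15787),
# line `birth` (registered), glue stub `stub_centralVanishing_of_finite`

Registered glue stub of the skeleton `Cruxes/PhantomShadow/Lines/birth.lean`: for a weight-`2`
cusp form `g` on `Γ₀(N)` and one of Shimura's abelian varieties `D : NewformAbelianVariety g`,
if every entire continuation `Λ` of the `L`-series `Σ aₘ(g) m^(-s)` (agreement on `re s > 2`)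
with `Λ 1 ≠ 0` forces `A_g(ℚ) = D.A.Points ℚ` to be finite (the Kato instance at `(N, g, D)`,
supplied by the neighbouring stub), and `A_g(ℚ)` is infinite, then some entire continuation `Λ`
of that `L`-series vanishes at `s = 1`.

Proof: Hecke's analytic continuation is proved in tree
(`Literature.NumberTheory.EllipticCurves.ModularForms.exists_differentiable_eq_cuspFormLSeries_holds`,
Hecke 1936; Diamond–Shurman Thm. 5.10.2): there is an entire `L` with `L s = cuspFormLSeries g s`
for `re s > k/2 + 1 = 2`, and `cuspFormLSeries g s = LSeries (fun m ↦ (qExpansion 1 ⇑g).coeff m) s`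
definitionally. Take `Λ := L`; were `Λ 1 ≠ 0`, the first hypothesis would make `A_g(ℚ)` finite,
contradicting `Infinite (D.A.Points ℚ)`.
-/

set_option linter.dupNamespace false

noncomputable section

namespace Summit.BirchSwinnertonDyer.BirchSwinnertonDyer.Theorems

open Literature.NumberTheory.EllipticCurves.ModularForms

/-- Glue stub (Kato-at-`(N, g, D)` + `A_g(ℚ)` infinite ⇒ central vanishing): if every entire
continuation `Λ` of `L(g, s) = Σ aₘ(g) m^(-s)` (agreement on `re s > 2`) with `Λ 1 ≠ 0` forces
`D.A.Points ℚ` to be finite, and `D.A.Points ℚ` is infinite, then Hecke's entire continuation of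
`L(g, s)` (Hecke 1936; Diamond–Shurman Thm. 5.10.2, proved in tree as
`exists_differentiable_eq_cuspFormLSeries_holds`) vanishes at `s = 1`. [folklore] -/
theorem stub_centralVanishing_of_finite : ∀ (N : ℕ) [NeZero N] (g : CuspForm (CongruenceSubgroup.Gamma0 N) 2) (D : Literature.NumberTheory.EllipticCurves.ModularForms.NewformAbelianVariety g), (∀ Λ : ℂ → ℂ, Differentiable ℂ Λ → (∀ s : ℂ, 2 < s.re → Λ s = LSeries (fun m ↦ (UpperHalfPlane.qExpansion 1 ⇑g).coeff m) s) → Λ 1 ≠ 0 → Finite (D.A.Points ℚ)) → Infinite (D.A.Points ℚ) → ∃ Λ : ℂ → ℂ, Differentiable ℂ Λ ∧ (∀ s : ℂ, 2 < s.re → Λ s = LSeries (fun m ↦ (UpperHalfPlane.qExpansion 1 ⇑g).coeff m) s) ∧ Λ 1 = 0 := by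
  intro N _ g D hK hinf
  obtain ⟨L, hL, hLeq⟩ := exists_differentiable_eq_cuspFormLSeries_holds (k := 2) g
  have hagree : ∀ s : ℂ, 2 < s.re → L s = LSeries (fun m ↦ (UpperHalfPlane.qExpansion 1 ⇑g).coeff m) s :=
    fun s hs ↦ hLeq s (by push_cast; linarith)
  refine ⟨L, hL, hagree, ?_⟩
  by_contra h1
  haveI : Finite (D.A.Points ℚ) := hK L hL hagree h1
  exact not_finite (D.A.Points ℚ)

end Summit.BirchSwinnertonDyer.BirchSwinnertonDyer.Theorems

end
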